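import Summits.RiemannHypothesis.RiemannHypothesis.Theorems.GroundBartaEvenWinsBeyondArchCellsUpTo78
import Summits.RiemannHypothesis.RiemannHypothesis.Theorems.GroundBartaEvenWinsBeyondArchDeflationM80FOddLowerGW
import Summits.RiemannHypothesis.RiemannHypothesis.Theorems.WeilParityEvenWinsBeyondArchFrontier80OfOddLower
import HarnessLib

/-!
# RiemannHypothesis / GroundBarta — rung 4: the parity ladder reaches `4023/5000` (the three-prime window up to `0.8046`)

Helper file (`--supports stmt-RiemannHypothesis-18085`), RH-free (prover A g5 template, landed by g7): with
`m80F_oddLower_litW : 1/6e15 < 21/10^17 ∧ 21/10^17 ≤ ε_od(4023/5000)` (file …DeflationM80FOddLowerGW, cell 5, N = 271 format) and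
`weilWindowSimpleEven_upTo_M78` (cell 4), this closes `WeilWindowSimpleEven` on `(0, 4023/5000]`.
-/

-- D-0017: single-problem summit ⇒ namespace `Summit.RiemannHypothesis.RiemannHypothesis.…` by design.
set_option linter.dupNamespace false

noncomputable section

namespace Summit.RiemannHypothesis.RiemannHypothesis.Theorems.EvenWinsBeyondArch

open Literature.NumberTheory.LFunctions

/-- **`WeilWindowSimpleEven a` for every `0 < a ≤ 4023/5000`** (cells up to `39/50`, then `[39/50, 4023/5000]`). [folklore] -/
theorem weilWindowSimpleEven_upTo_M80 : ∀ a : ℝ, 0 < a → a ≤ 4023 / 5000 → WeilWindowSimpleEven a :=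
  weilWindowSimpleEven_upTo_M80_of_oddLower weilWindowSimpleEven_upTo_M78 m80F_oddLower_litW.1 m80F_oddLower_litW.2

/-- Tail shape of item 18085 up to `4023/5000`. [folklore] -/
theorem tailSimpleEven_upTo_M80 : ∀ a : ℝ, Real.log 2 < a → a ≤ 4023 / 5000 → WeilWindowSimpleEven a :=
  fun a ha hle ↦ weilWindowSimpleEven_upTo_M80 a ((Real.log_pos (by norm_num)).trans ha) hle

end Summit.RiemannHypothesis.RiemannHypothesis.Theorems.EvenWinsBeyondArch

end
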